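import Summits.QuantumFields.YangMills.Theorems.DiagonalMirrorRPRWilsonDiagonalModelOddTorusChain
import Literature.Analysis.OperatorTheory.ExpInnerProductKernelPositivity
import Mathlib.Analysis.CStarAlgebra.Matrix
import Literature.MathematicalPhysics.QuantumFieldTheory.TiltedTorusSwapRP

/-!
# Crux `DiagonalMirrorRPR` (stmt-QuantumFields-10604), line `sign-twisted-diagonal-trace`, construction F1_diag
# (director-ym O4 WORD 3 (A)): the Schur cut of the diagonal step is of POSITIVE TYPE for `β ≥ 0`
# (kernel level of the card's `B̂ = Θ𝓑 ⪰ 0`)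

Helper for the crux `DiagonalMirrorRPR` of `YangMills` (routes `IsotropyFromPowerCounting`, `MirrorModularBoosts`,
`PencilRigidity`; item stmt-QuantumFields-10604), attached `--supports … --as helper`; it closes nothing by itself.
Continuation of `…Theorems.DiagonalMirrorRPRWilsonDiagonalModelOddTorusChain` (symmetric chart of the odd torus, half steps
`evenActionU` / `oddActionU`, bond-label involution `thetaHalf`, diamonds `diamond`, `evenActionU_thetaHalf`).

* `re_trace_mul_star_eq_sum`, **`re_trace_map_mul_inv_eq_sum`** (with the tree's `TiltedTorusRP.map_inv_eq_star`) — for a UNITARY representation,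
  Wilson's coupling `Re tr ρ(g h⁻¹) = Re tr(ρ(g) ρ(h)†) = Σ_{a,b} (Re ρ(g)_{ab} Re ρ(h)_{ab} + Im ρ(g)_{ab} Im ρ(h)_{ab})` is a
  Euclidean inner product of REAL FEATURE VECTORS;
* `bondFeature ρ Y` (the real/imaginary parts of the entries of `ρ(D_u(Y))` over all diamonds), `inslabAction ρ X`, and
  **`evenActionU_thetaHalf_eq_sum_feature`**: `even(Y, X, ΘY″) = ⟨w(Y″), w(Y)⟩ + inslab(X)`; `abs_bondFeature_le_one`
  (unitary entries), `measurable_bondFeature`; `halfHaar` (product Haar on a half layer);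
* ★ **`integral_mul_exp_twistedEven_mul_nonneg`** — for `β ≥ 0`, every in-slab configuration `X` and every bounded
  measurable real `f` on bond half layers: `0 ≤ ∫∫ f(Y) exp(β · even(Y, X, ΘY″)) f(Y″) dY dY″`, by the feature expansion
  of the exponential kernel (`Literature.Analysis.OperatorTheory.integral_mul_exp_sum_mul_mul_nonneg`).  This is the
  positivity that makes the Θ-twisted even half step `Ê = E J` a POSITIVE self-adjoint operator — and, more usefully
  (see ROADMAP-F1diag v2 on the item), gives `Ê = Φ† Φ` for the EXPLICIT ℓ²-valued feature map `Φ` of the exponential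
  kernel, so that the self-adjoint realisation `Φ Ô Φ†` of the two-step operator `K_u = Ê Ô` is an honest
  square-integrable SYMMETRIC kernel on (feature index) × (in-slab half layer), to which the tree's `L²`-kernel
  Hilbert–Schmidt package (`Literature/Analysis/OperatorTheory/L2Kernel{IntegralOperator,HilbertSchmidt,Pairing}`)
  applies with no trace-class input.

OWED: that operator layer and the `famObs` pairing layer; no `def wilsonDiagonalModel : DiagonalSliceModel r sch` yet.
HONEST FRAMING: a construction helper; nothing about D_old ⟨10604⟩, the RP crux of the FOLD restate, or the summit is proved;
the Yang–Mills mass gap is NOT proved here or anywhere in the tree.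

References: K. Osterwalder, E. Seiler, Ann. Phys. 110 (1978) §2–3 (bond-plane reflection positivity of Wilson's action);
E. Seiler, LNP 159 (1982) Ch. 2; C. Berg, J. P. R. Christensen, P. Ressel, *Harmonic Analysis on Semigroups* (1984)
Ch. 3 §1 (Schur products / exponentials of positive definite kernels).
-/

set_option autoImplicit false

noncomputable section

open MeasureTheory
open Literature.MathematicalPhysics.QuantumLattice Literature.MathematicalPhysics.QuantumFieldTheory
open Summit.QuantumFields.YangMills.Cruxes.DiagonalMirrorRPR.ParityBridgeColdTraces

namespace Summit.QuantumFields.YangMills.Cruxes.DiagonalMirrorRPR.SignTwistedDiagonalTrace.WilsonDiagonal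

/-! ## §12 The Schur cut is of positive type for `β ≥ 0` (kernel level of `B̂ = Θ𝓑 ⪰ 0`) -/

section Feature

variable {Nc : ℕ}

/-- `Re tr(A B†) = Σ_{a,b} (Re A_{ab} Re B_{ab} + Im A_{ab} Im B_{ab})`: the real Hilbert–Schmidt pairing of complex matrices is
the Euclidean pairing of their real feature vectors. -/
theorem re_trace_mul_star_eq_sum (A B : Matrix (Fin Nc) (Fin Nc) ℂ) :
    (A * star B).trace.re = ∑ a : Fin Nc, ∑ b : Fin Nc, ((A a b).re * (B a b).re + (A a b).im * (B a b).im) := by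
  simp only [Matrix.trace, Matrix.diag_apply, Matrix.mul_apply, Matrix.star_apply, Complex.re_sum,
    Complex.mul_re, Complex.star_def, Complex.conj_re, Complex.conj_im]
  refine Finset.sum_congr rfl fun a _ => Finset.sum_congr rfl fun b _ => ?_
  ring

variable {G : Type*} [Group G] (ρ : G →* Matrix (Fin Nc) (Fin Nc) ℂ)

/-- `Re tr ρ(g h⁻¹) = Σ_{a,b} (Re ρ(g)_{ab} Re ρ(h)_{ab} + Im ρ(g)_{ab} Im ρ(h)_{ab})` for unitary `ρ`: Wilson's link/diamond
coupling is a Euclidean inner product of real feature vectors (the Gram structure behind every Schur cut). -/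
theorem re_trace_map_mul_inv_eq_sum (hρu : ∀ g, ρ g ∈ Matrix.unitaryGroup (Fin Nc) ℂ) (g h : G) :
    (ρ (g * h⁻¹)).trace.re =
      ∑ a : Fin Nc, ∑ b : Fin Nc, ((ρ g a b).re * (ρ h a b).re + (ρ g a b).im * (ρ h a b).im) := by
  rw [map_mul, Literature.MathematicalPhysics.QuantumFieldTheory.TiltedTorusRP.map_inv_eq_star ρ hρu,
    re_trace_mul_star_eq_sum]

end Feature

section SchurCut

variable {S : ℕ} [NeZero S] {G : Type*} [Group G] {Nc : ℕ} (ρ : G →* Matrix (Fin Nc) (Fin Nc) ℂ)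

/-- Feature indices of a bond half layer: slab site, matrix entry, real/imaginary part. -/
abbrev FeatIdx (S Nc : ℕ) : Type := SlabSite S S × Fin Nc × Fin Nc × Fin 2

/-- **The real feature map of a bond half layer**: the real and imaginary parts of the entries of `ρ(D_u(Y))` over all
diamonds `D_u(Y) = Y(u,1) Y(u+1,0)`. -/
def bondFeature (Y : HalfCfg S S G) (q : FeatIdx S Nc) : ℝ :=
  if q.2.2.2 = 0 then (ρ (diamond Y q.1) q.2.1 q.2.2.1).re else (ρ (diamond Y q.1) q.2.1 q.2.2.1).im

/-- The in-slab `(2,3)` plaquette sum of an in-slab half layer (the `Y`-independent part of the even half step). -/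
def inslabAction (X : HalfCfg S S G) : ℝ :=
  ∑ s : SlabSite S S, (ρ (X (s, 0) * X (s + slabStep 2, 1) * (X (s + slabStep 3, 0))⁻¹ * (X (s, 1))⁻¹)).trace.re

/-- **The Θ-twisted even half step is a Gram form plus a constant**: for unitary `ρ`,
`even(Y, X, ΘY″) = ⟨w(Y″), w(Y)⟩ + inslab(X)` with the real feature map `w = bondFeature ρ`. -/
theorem evenActionU_thetaHalf_eq_sum_feature (hρu : ∀ g, ρ g ∈ Matrix.unitaryGroup (Fin Nc) ℂ)
    (Y X Y'' : HalfCfg S S G) :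
    evenActionU ρ Y X (thetaHalf Y'') =
      (∑ q : FeatIdx S Nc, bondFeature ρ Y'' q * bondFeature ρ Y q) + inslabAction ρ X := by
  rw [evenActionU_thetaHalf, Finset.sum_add_distrib, inslabAction]
  congr 1
  rw [Fintype.sum_prod_type (f := fun q : FeatIdx S Nc => bondFeature ρ Y'' q * bondFeature ρ Y q)]
  refine Finset.sum_congr rfl fun s _ => ?_
  rw [re_trace_map_mul_inv_eq_sum ρ hρu,
    Fintype.sum_prod_type (f := fun ab : Fin Nc × Fin Nc × Fin 2 => bondFeature ρ Y'' (s, ab) * bondFeature ρ Y (s, ab))]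
  refine Finset.sum_congr rfl fun a _ => ?_
  rw [Fintype.sum_prod_type (f := fun bc : Fin Nc × Fin 2 => bondFeature ρ Y'' (s, a, bc) * bondFeature ρ Y (s, a, bc))]
  refine Finset.sum_congr rfl fun b _ => ?_
  rw [Fin.sum_univ_two]
  simp [bondFeature]

omit [NeZero S] in
/-- The features are bounded by `1` (entries of unitary matrices). -/
theorem abs_bondFeature_le_one (hρu : ∀ g, ρ g ∈ Matrix.unitaryGroup (Fin Nc) ℂ) (Y : HalfCfg S S G)
    (q : FeatIdx S Nc) : |bondFeature ρ Y q| ≤ 1 := by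
  have h := entry_norm_bound_of_unitary (hρu (diamond Y q.1)) q.2.1 q.2.2.1
  unfold bondFeature
  split_ifs
  · exact (Complex.abs_re_le_norm _).trans h
  · exact (Complex.abs_im_le_norm _).trans h

variable [TopologicalSpace G] [IsTopologicalGroup G] [MeasurableSpace G] [BorelSpace G] [SecondCountableTopology G]

/-- The features are measurable (continuous `ρ`, second countable `G`). -/
theorem measurable_bondFeature (hρ : Continuous ρ) (q : FeatIdx S Nc) :
    Measurable fun Y : HalfCfg S S G => bondFeature ρ Y q := by
  unfold bondFeature diamond
  have hc : Continuous fun Y : HalfCfg S S G => ρ (Y (q.1, 1) * Y (q.1 + slabStep 1, 0)) q.2.1 q.2.2.1 :=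
    (Continuous.matrix_elem (hρ.comp (by fun_prop)) _ _)
  split_ifs
  · exact (Complex.continuous_re.comp hc).measurable
  · exact (Complex.continuous_im.comp hc).measurable

variable (S G) in
/-- Product Haar probability measure on a half layer. -/
def halfHaar [CompactSpace G] : Measure (HalfCfg S S G) :=
  Measure.pi fun _ : SlabSite S S × Fin 2 => haarProbability G

variable [CompactSpace G]

/-- **The Schur cut is of positive type for `β ≥ 0`** (kernel level of the card's `B̂ = Θ𝓑 ⪰ 0 iff β ≥ 0`, the
positivity half): for every in-slab configuration `X` and every bounded measurable real `f` on bond half layers,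
`0 ≤ ∫∫ f(Y) exp(β · even(Y, X, ΘY″)) f(Y″) dY dY″` — because `even(Y, X, ΘY″) = ⟨w(Y), w(Y″)⟩ + const` and
`exp(β⟨w, w′⟩)` is a kernel of positive type (`Literature…integral_mul_exp_sum_mul_mul_nonneg`, the feature expansion of the
exponential).  This is the ingredient that makes `Ê = E J` a POSITIVE self-adjoint operator and `A = Ê^{1/2} Ô Ê^{1/2}`
available (OWED, operator layer). -/
theorem integral_mul_exp_twistedEven_mul_nonneg (hρu : ∀ g, ρ g ∈ Matrix.unitaryGroup (Fin Nc) ℂ) (hρ : Continuous ρ)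
    {β : ℝ} (hβ : 0 ≤ β) (X : HalfCfg S S G) (f : HalfCfg S S G → ℝ) (hf : Measurable f) (C : ℝ)
    (hC : ∀ Y, |f Y| ≤ C) :
    0 ≤ ∫ z : HalfCfg S S G × HalfCfg S S G, f z.1 * Real.exp (β * evenActionU ρ z.1 X (thetaHalf z.2)) * f z.2
      ∂((halfHaar S G).prod (halfHaar S G)) := by
  haveI : IsFiniteMeasure (halfHaar S G) := by unfold halfHaar; infer_instance
  -- reindex the features over `Fin p`
  set e : FeatIdx S Nc ≃ Fin (Fintype.card (FeatIdx S Nc)) := Fintype.equivFin (FeatIdx S Nc) with he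
  set v : HalfCfg S S G → Fin (Fintype.card (FeatIdx S Nc)) → ℝ := fun Y j => bondFeature ρ Y (e.symm j) with hv
  have hsum : ∀ Y Y'' : HalfCfg S S G,
      ∑ q : FeatIdx S Nc, bondFeature ρ Y'' q * bondFeature ρ Y q = ∑ j, v Y j * v Y'' j := by
    intro Y Y''
    rw [← e.symm.sum_comp]
    exact Finset.sum_congr rfl fun j _ => mul_comm _ _
  have hpos := Literature.Analysis.OperatorTheory.integral_mul_exp_sum_mul_mul_nonneg (halfHaar S G) v
    (fun j => measurable_bondFeature ρ hρ (e.symm j)) 1 (fun Y j => abs_bondFeature_le_one ρ hρu Y (e.symm j))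
    β hβ f hf C hC
  have hrw : (fun z : HalfCfg S S G × HalfCfg S S G =>
      f z.1 * Real.exp (β * evenActionU ρ z.1 X (thetaHalf z.2)) * f z.2) =
      fun z => Real.exp (β * inslabAction ρ X) * (f z.1 * Real.exp (β * ∑ j, v z.1 j * v z.2 j) * f z.2) := by
    funext z
    rw [evenActionU_thetaHalf_eq_sum_feature ρ hρu, hsum, mul_add, Real.exp_add]
    ring
  rw [hrw, integral_const_mul]
  exact mul_nonneg (Real.exp_pos _).le hpos

end SchurCut

end Summit.QuantumFields.YangMills.Cruxes.DiagonalMirrorRPR.SignTwistedDiagonalTrace.WilsonDiagonal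

end
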